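import Mathlib
import HarnessLib
import HarnessLib.Audit
import Summits.AtomisticToContinuum.Statement
import Literature.MathematicalPhysics.QuantumManyBody.PeriodicBoseGas
import HarnessLib.Audit.Status.Attr

/-!
Route: BECDressedKac

DORMANT since 2026-08-29T19:25:57Z (census g0: costume|duplicate of —; reader census-reader-31-g0) — unstaffed, not closed; items shared with open routes are served there. `ledger route dormant <id> --off` reactivates.

# Route BECDressedKac — dilute Bose gas as an exactly dressed positive-type Kac model — tune
a(v−w)=0, then Kac-window condensation

It suffices to show X = SplittingConstruction ∧ DressedKacCondensation ∧ BoundaryTransferWeak (card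
jastrow-parent-kac-splitting, items
J0 and J3 made formal on the TORUS; D-0027-conforming re-filing of the retired route BECJastrowKac,
whose decls it sharpens: positive
type of the Kac part, global minimality, and a PROVED deciding theorem). SplittingConstruction:
every repulsive finite-range v admits,
at every large radius R, an EXACT positive-type Jastrow–Kac splitting — a measurable Kac part w ≥ 0
of positive type, range R, height
≤ A/R³, mass ∫w ≤ A (A ≈ 16πa), and a profile 0 ≤ f ≤ 1, f = 1 beyond R, punctured-Lipschitz, defect
∫(1−f²) ≤ AR², such that
E_{v−w}[f] := ∫2|∇f|² + (v−w)f² = 0 and E_{v−w}[φ] ≥ 0 for every C¹ φ equal to 1 near infinity (⇔ f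
is the positive zero-energy
solution of v − w and v − w has scattering length ZERO: the whole scattering length sits,
Born-exactly, in w, ∫wf² = ∫2|∇f|²+vf²).
DressedKacCondensation: universal thresholds M, η, ε₀ exist such that for every (v, w, f, R) so
related and every density in the
window ρR³ ≥ M (Kac number), ρR²∫w ≤ η (sub-healing), w ≤ η/R² (Born), ρ∫(1−f²) ≤ ε₀ (Mayer),
δ-near-minimisers of the periodic
energy OF v on the torus of side (N/ρ)^{1/3} have constant-mode occupation ≥ cN for all large N. Its
f ≡ 1, v = w instance
KacWindowCondensation — the positive-type weakly coupled Kac gas itself — is ranked first: it is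
where the mechanism (Kac–Siegert real
Gaussian field in the density channel + CLT for collective modes with parameter (ρR³)^{-1/2}) must
work before any dressing.
WindowArithmetic (support, proved in the planner's Check.lean) puts every v in the window at R =
(M/ρ)^{1/3} for ρ < ρ₀(v), giving
PeriodicBEC (target, shared stmt-AtomisticToContinuum-0826); BoundaryTransferWeak (shared crux
stmt-AtomisticToContinuum-0827) carries
torus ⇒ Dirichlet λ_max(γ) ≥ cN, i.e. the sub-problem Statement.
Lean: `SplittingConstruction ∧ DressedKacCondensation ∧ BoundaryTransferWeak`

## Assembly
Pure logic (Sketch.lean / Check.lean rc 0, axioms propext / Classical.choice / Quot.sound): fix v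
repulsive finite-range; WindowArithmetic
applied to SplittingConstruction and DressedKacCondensation gives PeriodicBEC, hence its body for v;
BoundaryTransferWeak turns that into
∃ρ₀ ∀ρ<ρ₀ HasGroundStateBEC v ρ, i.e. the sub-problem Statement decl
`_root_.BoseEinsteinCondensation` (abbrev of the Literature
conjecture). Deciding theorem (glue.lean): `theorem closes (h₁ : SplittingConstruction) (h₂ :
DressedKacCondensation) (h₃ : WindowArithmetic)
(h₄ : BoundaryTransferWeak) : _root_.BoseEinsteinCondensation := fun v hv => h₄ v hv (h₃ h₁ h₂ v
hv)`; with the planner's proof of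
WindowArithmetic substituted, `closes'` from the three leaves alone is kernel-closed in Check.lean.
KacWindowCondensation is deliberately
NOT a hypothesis of `closes`: it is the f ≡ 1 instance of DressedKacCondensation (support
KacWindowOfDressed, proved), so any proof of
rank 3 contains a proof of rank 2 and any refutation of rank 2 refutes rank 3 and closes the route —
it is ranked first as the place
the mechanism must work, and stays directly claimable. `example : Assembly := closes` checks that
the Assembly item is literally its type.

Rationale: WHY THIS LINE. The Jastrow-parent identity H = H_J + Σ_{i<j} w(x_i−x_j) − W₃ (H_J = −Δ + Σ(v−w) + W₃
≥ 0, H_JΨ_J = 0, Ψ_J = Πf(x_i−x_j),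
W₃ = Σ_iΣ_{j≠k}(∇f/f)(x_i−x_j)·(∇f/f)(x_i−x_k)) is exact; tuning the amplitude κ of a FIXED
positive-type bump w = κφ₁(·/R) until the
scattering length of v − w vanishes (IVT: a(v − κφ₁) decreases continuously from a > 0 through 0
inside the Born range κR² ≪ 1) moves
the whole scattering length into a smooth, positive, positive-TYPE repulsion of range R and Born
mass ∫wf² = 8πa(1+O(a/R)), while for R
in the window ρ^{-1/3} ≪ R ≪ ξ = (8πρa)^{-1/2} the reference |Ψ_J|² is a Mayer-convergent classical
gas (parameter ρ∫(1−f²) ≍ ρaR²) and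
w is a KAC potential (ρR³ ≫ 1): the dilute gas, hard cores included, becomes a cluster-convergent
reversible diffusion plus a mean-field
two-body term with two explicit small parameters (BastiCenatiempoSchlein2021 and arXiv:2212.04431
use the identity as an upper-bound
device; FournaisSolovej2020 dress by the scattering solution before Bogoliubov; parent Hamiltonians
of Jastrow states:
doi:10.21468/scipostphyscore.4.4.030; CBF physics doi:10.1016/0375-9474(79)90212-4,
ReattoChester1967). Imported areas: classical
Kac / van der Waals theory (LebowitzPenrose1966; quantum limit Lieb1966; finite range
Lebowitz–Mazel–Presutti
doi:10.1023/A:1004591218510 = Kac–Siegert + expansion around mean field — positive type makes the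
Hubbard–Stratonovich density field a
REAL Gaussian measure, not Benfatto's complex one), canonical-ensemble cluster expansions
(PulvirentiTsagkarogiannis2012), Jastrow ODLRO
(Reatto1969). What it does that other routes do not: BECParentAnchor (same identity) files RELATIVE
corrector-flatness cruxes with no
window and no Kac structure; BECMeanFieldControl anchors −log Ψ₀ in the mean-field corner as a
control value; here one identity plus
one tuning produces an explicit reference and a positive-type MEAN-FIELD perturbation, and the first
crux isolates the positive-type
weak Kac gas — the literature's standing class (Seiringer2011, GiulianiSeiringer2009,
DerezinskiNapiorkowski2014 all assume v̂ ≥ 0) in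
which thermodynamic-limit condensation is open (DerezinskiNapiorkowski2014 §1: "the thermodynamic
limit with a fixed coupling constant
... is at the moment out of reach", volumes L^18 ≲ N) and at positive temperature even CLAIMED (Sütő
arXiv:2208.08931, u ≥ 0 and û ≥ 0,
via cycle lengths; unrefereed). Negatives index (6 entries, 1 BEC: BECSwapAffinity.SwapJensen,
stmt-3980) shares nothing with this route.

RANKED CRUXES. #0 PeriodicBEC (target) — constant-mode BEC for δ-near-minimisers of the periodic
N-body energy on the torus of side (N/ρ)^{1/3}, every repulsive finite-range v, all small ρ —
verbatim the shared item stmt-AtomisticToContinuum-0826 (BECPeriodicReduction.PeriodicBEC); reached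
here by WindowArithmetic from SplittingConstruction ∧ DressedKacCondensation. (why it might fail:
the textbook open problem (LSSY2005 §1.2, Ch. 5); for this route it fails iff DressedKacCondensation
or SplittingConstruction fails (WindowArithmetic is proved).) [LSSY2005, Fournais2020, Junge2026]
#2 KacWindowCondensation (crux) — PURE positive-type Kac-window condensation (card J3 with f ≡ 1):
there are universal M, η > 0 such that for every measurable radial w : ℝ → [0,∞] with w ≤ η/R²
(Born), w = 0 beyond R, x ↦ w(|x|) of positive type (all finite Bochner sums Σ c_i c_j w(|y_i −
y_j|) ≥ 0), and every density with ρR³ ≥ M (Kac number) and ρR²∫_{ℝ³}w ≤ η (sub-healing, R ≪ ξ),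
δ-near-minimisers of the periodic N-body energy of w on the torus of side (N/ρ)^{1/3} have
constant-mode occupation ≥ cN for all large N (c, the N-threshold and δ may depend on everything).
Scale-covariant; the v := w, f := 1 instance of DressedKacCondensation (support KacWindowOfDressed,
proved); physically the weakly depleted Bogoliubov fluid, no roton sector (ŵ ≥ 0 ⇒ E(k)² = k⁴ +
2ρŵ(k)k² ≥ k⁴), depletion ≲ η^{3/2}/M. [difficulty: open-problem] (why it might fail: Uniformity in
L=(N/ρ)^{1/3}→∞ at fixed (w,R,ρ): printed Bogoliubov control needs L^18≲N (DN2014) or fixed L; if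
ODLRO needs the large-field sector beyond ξ = R/√η, mean field + CLT in (ρR³)^{-1/2} is not uniform
in L (Benfatto1994, BFKT2017).) [DerezinskiNapiorkowski2014, Seiringer2011, GiulianiSeiringer2009,
Lieb1966, arXiv:2208.08931, doi:10.1103/physreve.71.016109, Benfatto1994, BFKT2017]
#3 DressedKacCondensation (crux) — DRESSED Kac-window condensation (card J3, general f): universal
M, η, ε₀ > 0 such that for all measurable v, w : ℝ → [0,∞] of range ≤ R with w ≤ η/R² and x ↦ w(|x|)
of positive type, all profiles f (0 ≤ f ≤ 1, f = 1 on [R,∞), x ↦ f|x| Lipschitz off every ball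
around 0) satisfying the EXACT splitting relations — value identity ∫(2|∇f|² + v f²) = ∫ w f² and
GLOBAL minimality ∫(2|∇f|²+vf²) + ∫wφ² ≤ ∫(2|∇φ|²+vφ²) + ∫wf² for every C¹ φ equal to 1 near
infinity (i.e. f is the zero-energy solution of v − w and a(v − w) = 0; hard cores v = ⊤ allowed, f
then vanishes on the core) — and every ρ > 0 in the window ρR³ ≥ M, ρR²∫w ≤ η, ρ∫(1−f²) ≤ ε₀:
δ-near-minimisers of the periodic energy OF v on the torus of side (N/ρ)^{1/3} have constant-mode
occupation ≥ cN for all large N. Proof line of the card: Ψ = (Πf)·g, exact identity ⟨Ψ,HΨ⟩ =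
∫F²|∇g|² + ∫|Ψ|²(Σw^per − W₃), reference ODLRO and CLT by cluster expansion of F² = Πf², Kac–Siegert
on Σw (real field, ŵ ≥ 0), W₃ of relative size ρ∫(1−f²). [deps: KacWindowCondensation] [difficulty:
open-problem] (why it might fail: Universal (M,η,ε₀) over all shapes (v,f) may not exist; the
attractive −W₃ and the cores must be dominated INSIDE the reference measure F² uniformly in L
(large-field problem); the reference cluster expansion is canonical-ensemble at Mayer parameter ε₀.)
[BastiCenatiempoSchlein2021, arXiv:2212.04431, Reatto1969, ReattoChester1967,
PulvirentiTsagkarogiannis2012, doi:10.1023/A:1004591218510, FournaisSolovej2020, LSSY2005]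
#4 SplittingConstruction (crux) — existence of the EXACT positive-type window splitting (card J0):
for every repulsive finite-range v there are A ≥ 0 and R₁ > 0 such that for every R ≥ R₁ there exist
a measurable Kac part w (0 ≤ w ≤ A/R³, w = 0 beyond R, ∫_{ℝ³}w ≤ A, x ↦ w(|x|) of positive type) and
a profile f (0 ≤ f ≤ 1, f = 1 on [R,∞), punctured-Lipschitz, ∫(1−f²) ≤ AR²) satisfying the two
splitting relations of DressedKacCondensation with v (and v = 0 beyond R). Construction (amplitude
tuning): fix a positive-type radial bump φ₁ supported in the unit ball (an autocorrelation 1_B∗1_B,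
or a Wendland function), put w_κ = κφ₁(·/R); the zero-energy minimiser f_κ of E_{v−w_κ} on {φ = 1
off B_R} exists for κφ₁(0)R² < 2π² (coercive), its minimum m(κ) is concave, continuous, m(0) =
8πa/(1−a/R) > 0 and m(κ*) ≤ 0 at the Born value κ*R³∫φ₁ ≈ 8πa; at the zero κ₀ of m the energy
identity gives f′(R⁻) = 0, so f extends by 1 to a global zero-energy solution (ground-state
substitution ⇒ global minimality), Sturm comparison keeps f > 0 off the core, and 0 ≤ f ≤ 1, 1 − f ≤
ca/r on [R₀,R] once R₁/R₀ is large; a = 0 ⇒ v = 0 a.e. ⇒ w = 0, f = 1, A = 0. [difficulty: L] (why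
it might fail: Exactness AND positive type force amplitude tuning: needs existence and κ-continuity
of the zero-energy minimiser of the SIGN-INDEFINITE v − κφ₁ for every measurable v ≥ 0 incl. hard
cores, f′(R)=0 from the energy identity, and 0≤f≤1 (needs R₁≫R₀); a wrong regularity clause makes it
false.) [LSSY2005, Fournais2020,
Literature.MathematicalPhysics.QuantumManyBody.BoseGas.LSSY2005_scatteringSolution,
doi:10.1007/BF02123482, arXiv:2208.08931, BastiCenatiempoSchlein2021]
#5 BoundaryTransferWeak (crux) — (shared verbatim with stmt-AtomisticToContinuum-0827, routes
BECParentAnchor / BECIroning / BECLaplacianL1 …) for each repulsive finite-range v, the PeriodicBEC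
body for v (torus of side (N/ρ)^{1/3}, constant-mode occupation ≥ cN for δ-near-minimisers, all
small ρ) implies ∃ρ₀ > 0 ∀ρ ∈ (0,ρ₀) HasGroundStateBEC v ρ (Dirichlet box, λ_max(γ) ≥ cN via
condensateNumber). The splitting identity itself is boundary-condition agnostic, but the
Kac–Siegert/CLT step wants translation invariance (constant mode, density CLT), so the mechanism
runs on the torus and the transfer is a separate, shared crux (expected: Neumann bracketing of
interior sub-boxes + the mode-free criterion λ_max ≥ tr γ²/N). [difficulty: L] (why it might fail:
The torus hypothesis never fires on the Dirichlet ground state (wall energy ≫ δ above E₀^per;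
interior restrictions are neither periodic nor sharp-N): no energy-comparison proof; needs a
structural transfer not in print; BEC can be BC-sensitive (Robinson1976).) [LSSY2005,
BoccatoSeiringer2023, Basti2022, Junge2026, Robinson1976, Fournais2020]
#9 WindowArithmetic (support) — the window is non-empty for every potential at every small density:
SplittingConstruction → DressedKacCondensation → PeriodicBEC. Proof (done in the planner's folder
Check.lean, rc 0, axioms propext/Classical.choice/Quot.sound; to be re-landed in Theorems/ by any
prover): B := A+1, R* := max(R₁, B/η, MB/η, MB/ε₀), ρ₀ := M/R*³; for 0 < ρ < ρ₀ put R := (M/ρ)^{1/3}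
≥ R*, so ρR³ = M, w ≤ A/R³ ≤ η/R², ρR²∫w ≤ ρR²A = MA/R ≤ η, ρ∫(1−f²) ≤ ρAR² = MA/R ≤ ε₀; instantiate
DressedKacCondensation at (v, w, f, R, ρ). [difficulty: provable-now] [LSSY2005]
#9 KacWindowOfDressed (support) — the pure Kac crux is the f ≡ 1, v := w instance of the dressed
crux: DressedKacCondensation → KacWindowCondensation (2·𝓔_w[1] = ∫w, ∫w φ² ≤ 2·𝓔_w[φ], defect 0).
PROVED in the planner's folder Check.lean (rc 0) — the interface check that the dressed hypotheses
are met by f ≡ 1; it also makes KacWindowCondensation refutation-load-bearing (¬Kac ⇒ ¬Dressed).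
[difficulty: provable-now] [LSSY2005, Lieb1966]

TWO-LAYER PLAN. Foreseen, not filed (k ≤ 3, depth 1 each): KacWindowCondensation ⇐ K1 → K2 →
KacWindowCondensation with K1 = a T = 0 Kac–Siegert /
Gaussian-domination-type infrared bound for torus near-minimisers of the positive-type Kac gas, n_p
≤ C(√(ρ∫w)/|p| + (ρŵ(p))²/p⁴)
uniformly in L (real Hubbard–Stratonovich field since ŵ ≥ 0), and K2 = the Parseval / mode-counting
sum rule on the torus (in-tree
PeriodicBoseGasFourier, the BECIroning ShellModeCounting pattern). DressedKacCondensation ⇐ D1 → D2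
→ DressedKacCondensation with D1 =
reference bounds for F² = Πf² (landscape flatness ∫Π_j f(x−y_j)dx ≥ L³(1 − ρ∫(1−f)), two-point
insertion ≥ c, CLT for density modes at
scale R: canonical cluster expansion at Mayer parameter ε₀, PulvirentiTsagkarogiannis2012 — provable
technology) and D2 = the dressed
infrared bound relative to F² (W₃ and cores dominated inside the measure). SplittingConstruction ⇐
S1 → S2 → SplittingConstruction with
S1 = zero-energy minimiser theory for v − κφ₁ (existence, energy identity, ray lower bound,
monotone-continuous dependence on κ;
generalising the in-tree PeriodicBoseGasScattering* files from w ≥ 0 to a bounded signed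
perturbation) and S2 = IVT in κ + pointwise bounds.
The N-body identity periodicEnergy v (F·g) = ∫F²|∇g|² + ∫|Fg|²(Σw^per − W₃), the three-body bound
−Σ_i|Σ_j∇u_ij|² ≤ −W₃ ≤ Σ_{i≠j}|∇u|²
and E₀^per < ⊤ in the window ride as --supports lemmas of rank 3.

KILL CRITERIA. ¬KacWindowCondensation (a positive-type, Born, sub-healing Kac gas with ρR³ ≥ M whose
torus ground states decondense as N → ∞, for
every choice of M, η) closes the route outright (close --reason refuted:KacWindowCondensation; via
KacWindowOfDressed it refutes rank 3
too) — and would be a discovery. ¬DressedKacCondensation with KacWindowCondensation standing ⇒ the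
dressing (cores / W₃ inside F², or
universality over shapes) is the obstruction: restate rank 3 for the FIXED Kac shape w = κφ₁(·/R)
delivered by rank 4 (new item, not a
rewording), else pivot to BECParentAnchor's relative statements; ¬SplittingConstruction as stated ⇒
restate the regularity / shape
clause (analysis, LSSY App. C level — not a kill); ¬BoundaryTransferWeak kills the Dirichlet
transfer for every torus route (shared fate
with BECParentAnchor, BECIroning, BECLaplacianL1 …) ⇒ pivot to a Dirichlet-direct dressed statement
with a wall factor. PeriodicBEC
proved elsewhere moots ranks 2–4; a refereed confirmation of Sütő's arXiv:2208.08931 would make rank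
2 adjacent to known (its T > 0
cycle statement still needs T → 0 and the near-minimiser form).

NOT DECOMPOSED YET. The Kac–Siegert / collective-field representation as a Lean object (no
functional integral in the library; the cruxes are stated over
the variational API only); the N-body splitting identity and the three-body bound (card J2) as items
— they are lemmas inside
DressedKacCondensation (--supports); reference ODLRO of the Jastrow state (elementary: Πφ_j ≥ 1 −
Σ(1−φ_j) gives n₀/N ≥ (1 −
ρ∫(1−f))², the LSSY (2.22)–(2.26) elimination, in tree as IsPairProfile.jastrowNormSq_erase_le);
finiteness of E₀^per in the window;
the glue KacWindowCondensation ← DressedKacCondensation beyond the proved instantiation; constants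
(M, η, ε₀ existential); the fixed
bump φ₁ (rank 4 may use any positive-type shape; rank 3 quantifies over all). No regime split at
open.

CHEAPEST FALSIFIER. (i) DONE this session, Lean: DressedKacCondensation → KacWindowCondensation
PROVED by instantiation (v := w, f := 1; Check.lean rc 0) —
the dressed interface is typed right — and WindowArithmetic PROVED (the window is non-empty for
every v at every small ρ), so `closes'`
from the three leaves is kernel-closed. (ii) Physics, one page: Bogoliubov depletion of the
positive-type Kac gas in the window is
≲ Cη^{3/2}/M, and ŵ ≥ 0 forbids roton softening at every coupling (E(k)² = k⁴ + 2ρŵ(k)k²); a refuter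
exhibiting an instability of the
uniform state INSIDE the window kills rank 2. (iii) Junk audit: E₀^per = ⊤ would falsify both
condensation cruxes — excluded (w
bounded; dressed: the Jastrow product state is admissible once (N−1)∫(1−f²) < L³, i.e. ε₀ < 1). (iv)
Lookup: status of Sütő's
unrefereed arXiv:2208.08931 (d ≥ 3 torus, u ≥ 0, û ≥ 0: BEC at low T / high ρ via macroscopic
cycles); if confirmed, rank 2's class
condenses at T > 0 and a T → 0 / variational transcription would make rank 2 a near-citation
(DerezinskiNapiorkowski2014 §1 and
Rougerie's EMS survey record no thermodynamic-limit theorem).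

NUMBERS. Window (card): R = a(ρa³)^{-s}, 1/3 < s < 1/2: ρR³ = (ρa³)^{1−3s} → ∞, ρaR² = (ρa³)^{1−2s}
→ 0, ξ = (8πρa)^{-1/2}. WindowArithmetic
(proved): R = (M/ρ)^{1/3}, B = A + 1, R* = max(R₁, B/η, MB/η, MB/ε₀), ρ₀ = M/R*³. In-window
diluteness is automatic: 8πa_v ≤ 2𝓔_v[f]
= ∫wf² ≤ ∫w ≤ η/(ρR²) ⇒ ρa_v³ ≤ η³/((8π)³M²). Kac part: κ ≈ 8πa/(R³∫φ₁) (Born), w ≤ κφ₁(0) =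
O(a/R³), ∫w = 8πa(1+O(a/R)), A ≈ 16πa +
O(R₀); defect ∫(1−f²) ≤ 4πaR²(1+o(1)). Roton check: for a NON-positive-type step Kac potential ŵ_min
= −0.086·∫w at kR ≈ 5.76, so
the uniform Bogoliubov state destabilises iff ρR²∫w ≳ 193 (cluster crystal); the η-window sits two
orders below and positive type
removes the sector entirely. Depletion (Bogoliubov/LHY): 1 − n₀/N ≈ (8/(3√π))(ρa³)^{1/2} (LSSY2005
Ch. 2). Known condensation scales:
Fournais2020 Thm 1.2 L = C(ρa³)^{-δ}(ρa)^{-1/2} (PROVED in tree: Fournais2020_condensation_holds);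
Junge2026 Cor. 6 a(ρa³)^{-3/4−η};
DerezinskiNapiorkowski2014 mean-field infinite volume L^{4d+6} ≤ bN^{1−α} (d = 3: L ≲ N^{1/18}).
Items at open: 8 (4 cruxes, 1 target,
2 supports, 1 assembly) + `closes`.

DEFINITION REQUESTS. None at open: positive type is inlined as the finite Bochner sums and the
splitting relations are inlined variationally over
scatteringFunctional / IsScatteringTrial of PeriodicBoseGas.lean, so every signature elaborates
standalone (Sketch.lean rc 0). Later,
once SplittingConstruction lands: a structure `JastrowKacSplitting v R` (topic
Summits/AtomisticToContinuum/BoseEinsteinCondensation/Theorems)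
bundling (w, f) and the relations, to shorten DressedKacCondensation and its children.

Novelty: Searches (2026-08-15, this seat): lit search local/hybrid — searchd unavailable (rc 75, ×3);
--source openalex / s2 / arxiv — HTTP 429;
--source crossref ×6: "weakly interacting Bose gas high density ground state energy" (→
GiulianiSeiringer2009), "Kac potential quantum
Bose gas condensation mean field finite range" (→ doi:10.1214/25-ejp1370 Bai–König–Vogel 2025,
mean-field TRAPPED ODLRO), "Bose gas
mean-field corrections Kac scaling parameter Martin Piasecki" (→ doi:10.1103/physreve.71.016109,
doi:10.1103/physreve.68.016113,
doi:10.1103/physreve.84.041122, doi:10.1007/978-3-540-73305-8_3), "excitation spectrum interacting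
bosons infinite volume mean-field
limit" (→ DerezinskiNapiorkowski2014 + erratum), "Sütő Bose-Einstein condensation interacting bosons
positive type", "simultaneous
occurrence off-diagonal long-range order infinite permutation cycles" (→ doi:10.1063/1.3095773);
--source zbmath "Bose-Einstein
condensation interacting positive type Suto" (2: arXiv:2208.08931, arXiv:2108.02659; read
arXiv:2208.08931 pp. 1–3); lit galaxy search
--star all ×7 ("Bose gas with Kac potential" 0, "Kac scaling Bose" 0, "mean-field Bose gas in
infinite volume" 0, "Jastrow parent
Hamiltonian" 0, "zero scattering length reference" 0, "weakly interacting Bose gas at high density"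
6: Rougerie EMS survey,
Carlen–Jauslin–Lieb simple equation II, Yin free energy, Cadamuro et al. volume). Card-level audits
(5 seats) had located
doi:10.21468/scipostphyscore.4.4.030, doi:10.1007/bf01019246, doi  [refs: 10.1214/25-ejp1370, 10.1103/physreve.71.016109, 10.1103/physreve.68.016113, 10.1103/physreve.84.041122, 10.1007/978-3-540-73305-8_3, 10.1063/1.3095773, 10.21468/scipostphyscore.4.4.030, 10.1007/bf01019246, 10.1016/0375-9474(79, 10.1017/fms.2021.66, 2208.08931, 2108.02659, 2212.04431, doi:10.1214/25-ejp1370, doi:10.1103/physreve.71.016109, doi:10.1103/physreve.68.016113, doi:10.1103/physreve.84.041]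

Barriers (technique_class: Jastrow-parent, Kac-potential, Kac-Siegert, cluster-expansion): - technique_class: Jastrow-parent, Kac-potential, Kac-Siegert, cluster-expansion
- Literature.Barriers.AtomisticToContinuum.BogoliubovPerturbationInfrared: applies to ranks 2–3
beyond the healing length IF attacked by finite-order expansion in the particle representation; the
line does not do that — after Kac–Siegert the variable is the collective density field, and positive
type makes the Hubbard–Stratonovich measure a REAL Gaussian (Benfatto's and BFKT's "complex Gaussian
measure" obstruction is for the coherent-state field); honest residue: uniform-in-L control of the
non-Gaussian remainder is a large-field problem (why-might-fail of rank 2).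
- Literature.Barriers.AtomisticToContinuum.BogoliubovPerturbationInfraredNarrow: its conjuncts on
the single G_c² bubble with momentum-independent vertices are the bet — ODLRO costs ONE phase
propagator, integrable on infrared balls iff d ≥ 2, and the collective vertices carry derivatives;
ranks 2–3 never compute Σ₁₂ or frequency-resolved anomalous correlators.
- Literature.Barriers.AtomisticToContinuum.KineticGapLengthScales: evaded by statement design — both
condensation cruxes are thermodynamic-limit claims at fixed ρ with δ after N; the small parameter is
(ρR³)^{-1/2} at the FIXED scale R, never the box gap c/L²; if a proof of rank 2 ends up needing the
collective modes' gap the barrier bites (flagged).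
- Literature.Barriers.AtomisticToContinuum.KineticGapLengthScalesNarrow: its Galilei-boost witness
decondenses states inside an O

History (route lifecycle, newest last):
- 2026-08-25T00:30:22Z · DORMANT — reconciler: no traction for 7.2 d (last activity item-evidence-added at 2026-08-17T18:55:01Z); parked, not closed — `ledger route dormant route-AtomisticToConti (operator:999:4112514)
- 2026-08-29T03:17:25Z · REACTIVATED — reconciler: reactivated — activity statement-checked at 2026-08-29T01:17:37Z after parking at 2026-08-25T00:30:22Z (operator:999:3617286)
- 2026-08-29T19:25:57Z · DORMANT — census g0: costume|duplicate of —; reader census-reader-31-g0 (operator:999:804925)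

sub-problem: BoseEinsteinCondensation · status: dormant · opened planner-plancard-AtomisticToContinuum-BoseEin-6f592076-g2-0 2026-08-15T19:10:25Z · rev 1 · ledger route-AtomisticToContinuum-BECDressedKac
GENERATED by the gate from the ledger (D-0016/17). Provers cite these decls: `theorem foo : Summit.AtomisticToContinuum.BoseEinsteinCondensation.Theses.BECDressedKac.<Decl> := …` in Summits/AtomisticToContinuum/BoseEinsteinCondensation/Theorems/<Name>.lean.
-/

namespace Summit.AtomisticToContinuum.BoseEinsteinCondensation.Theses.BECDressedKac

open scoped BigOperators Topology Manifold Classical MeasureTheory ProbabilityTheory Matrix InnerProductSpace ComplexConjugate ContinuousMap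
open Filter Set Function TopologicalSpace MeasureTheory

attribute [summit_statement] _root_.BoseEinsteinCondensation

/-- item stmt-AtomisticToContinuum-8997 · target · rank 0 · open · by planner
why it might fail: the textbook open problem (LSSY2005 §1.2, Ch. 5); for this route it fails iff DressedKacCondensation or SplittingConstruction fails (WindowArithmetic is proved).
sources: LSSY2005, Fournais2020, Junge2026
[target] constant-mode BEC for δ-near-minimisers of the periodic N-body energy on the torus of side
(N/ρ)^{1/3} at all small densities — verbatim the signature of BECPeriodicReduction.PeriodicBEC
(stmt-AtomisticToContinuum-0826); what X buys through ContinuationToPeriodicBEC (or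
CoreSubharmonicCoherence through CoreContinuation). -/
@[route_item "route-AtomisticToContinuum-BECDressedKac"]
def PeriodicBEC : Prop :=
  ∀ v : ℝ → ENNReal, Literature.MathematicalPhysics.QuantumManyBody.BoseGas.IsRepulsiveFiniteRange v → ∃ ρ₀ : ℝ, 0 < ρ₀ ∧ ∀ ρ : ℝ, 0 < ρ → ρ < ρ₀ → ∃ c : ℝ, 0 < c ∧ ∀ᶠ N : ℕ in Filter.atTop, ∃ δ : ENNReal, 0 < δ ∧ ∀ Ψ : Literature.MathematicalPhysics.QuantumManyBody.BoseGas.PeriodicTrialState N (Literature.MathematicalPhysics.QuantumManyBody.BoseGas.sideLength ρ N), Literature.MathematicalPhysics.QuantumManyBody.BoseGas.periodicEnergy v Ψ ≤ Literature.MathematicalPhysics.QuantumManyBody.BoseGas.periodicGroundStateEnergy v N (Literature.MathematicalPhysics.QuantumManyBody.BoseGas.sideLength ρ N) + δ → ENNReal.ofReal (c * N) ≤ Literature.MathematicalPhysics.QuantumManyBody.BoseGas.condensateOccupation N (Literature.MathematicalPhysics.QuantumManyBody.BoseGas.sideLength ρ N) Ψ.ψ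

/-- item stmt-AtomisticToContinuum-14630 · crux · rank 2 · open · by planner
why it might fail: Uniformity in L=(N/ρ)^{1/3}→∞ at fixed (w,R,ρ): printed Bogoliubov control needs L^18≲N (DN2014) or fixed L; if ODLRO needs the large-field sector beyond ξ = R/√η, mean field + CLT in (ρR³)^{-1/2} is not uniform in L (Benfatto1994, BFKT2017).
sources: DerezinskiNapiorkowski2014, Seiringer2011, GiulianiSeiringer2009, Lieb1966, arXiv:2208.08931, doi:10.1103/physreve.71.016109
[crux] PURE positive-type Kac-window condensation (card J3 with f ≡ 1): there are universal M, η > 0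
such that for every measurable radial w : ℝ → [0,∞] with w ≤ η/R² (Born), w = 0 beyond R, x ↦ w(|x|)
of positive type (all finite Bochner sums Σ c_i c_j w(|y_i − y_j|) ≥ 0), and every density with ρR³
≥ M (Kac number) and ρR²∫_{ℝ³}w ≤ η (sub-healing, R ≪ ξ), δ-near-minimisers of the periodic N-body
energy of w on the torus of side (N/ρ)^{1/3} have constant-mode occupation ≥ cN for all large N (c,
the N-threshold and δ may depend on everything). Scale-covariant; the v := w, f := 1 instance of
DressedKacCondensation (support KacWindowOfDressed, proved); physically the weakly depleted
Bogoliubov fluid, no roton sector (ŵ ≥ 0 ⇒ E(k)² = k⁴ + 2ρŵ(k)k² ≥ k⁴), depletion ≲ η^{3/2}/M.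
[difficulty: open-problem] -/
@[route_item "route-AtomisticToContinuum-BECDressedKac"]
def KacWindowCondensation : Prop :=
  open Literature.MathematicalPhysics.QuantumManyBody.BoseGas in ∃ M η : ℝ, 0 < M ∧ 0 < η ∧ ∀ (w : ℝ → ENNReal) (R ρ : ℝ), Measurable w → 0 < R → 0 < ρ → (∀ s, w s ≤ ENNReal.ofReal (η / R ^ 2)) → (∀ s, R < s → w s = 0) → (∀ (n : ℕ) (y : Fin n → Space) (c : Fin n → ℝ), 0 ≤ ∑ i, ∑ j, c i * c j * (w ‖y i - y j‖).toReal) → M ≤ ρ * R ^ 3 → ENNReal.ofReal (ρ * R ^ 2) * (∫⁻ x : Space, w ‖x‖) ≤ ENNReal.ofReal η → ∃ c : ℝ, 0 < c ∧ ∀ᶠ N : ℕ in Filter.atTop, ∃ δ : ENNReal, 0 < δ ∧ ∀ Ψ : PeriodicTrialState N (sideLength ρ N), periodicEnergy w Ψ ≤ periodicGroundStateEnergy w N (sideLength ρ N) + δ → ENNReal.ofReal (c * N) ≤ condensateOccupation N (sideLength ρ N) Ψ.ψ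

/-- item stmt-AtomisticToContinuum-14631 · crux · rank 3 · open · by planner
why it might fail: Universal (M,η,ε₀) over all shapes (v,f) may not exist; the attractive −W₃ and the cores must be dominated INSIDE the reference measure F² uniformly in L (large-field problem); the reference cluster expansion is canonical-ensemble at Mayer parameter ε₀.
sources: BastiCenatiempoSchlein2021, arXiv:2212.04431, Reatto1969, ReattoChester1967, PulvirentiTsagkarogiannis2012, doi:10.1023/A:1004591218510
[crux] DRESSED Kac-window condensation (card J3, general f): universal M, η, ε₀ > 0 such that for
all measurable v, w : ℝ → [0,∞] of range ≤ R with w ≤ η/R² and x ↦ w(|x|) of positive type, all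
profiles f (0 ≤ f ≤ 1, f = 1 on [R,∞), x ↦ f|x| Lipschitz off every ball around 0) satisfying the
EXACT splitting relations — value identity ∫(2|∇f|² + v f²) = ∫ w f² and GLOBAL minimality
∫(2|∇f|²+vf²) + ∫wφ² ≤ ∫(2|∇φ|²+vφ²) + ∫wf² for every C¹ φ equal to 1 near infinity (i.e. f is the
zero-energy solution of v − w and a(v − w) = 0; hard cores v = ⊤ allowed, f then vanishes on the
core) — and every ρ > 0 in the window ρR³ ≥ M, ρR²∫w ≤ η, ρ∫(1−f²) ≤ ε₀: δ-near-minimisers of the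
periodic energy OF v on the torus of side (N/ρ)^{1/3} have constant-mode occupation ≥ cN for all
large N. Proof line of the card: Ψ = (Πf)·g, exact identity ⟨Ψ,HΨ⟩ = ∫F²|∇g|² + ∫|Ψ|²(Σw^per − W₃),
reference ODLRO and CLT by cluster expansion of F² = Πf², Kac–Siegert on Σw (real field, ŵ ≥ 0), W₃
of relative size ρ∫(1−f²). [deps: KacWindowCondensation] [difficulty: open-problem] -/
@[route_item "route-AtomisticToContinuum-BECDressedKac", crux]
def DressedKacCondensation : Prop :=
  open Literature.MathematicalPhysics.QuantumManyBody.BoseGas in ∃ M η ε₀ : ℝ, 0 < M ∧ 0 < η ∧ 0 < ε₀ ∧ ∀ (v w : ℝ → ENNReal) (f : ℝ → ℝ) (R ρ : ℝ), Measurable v → Measurable w → 0 < R → 0 < ρ → (∀ s, R < s → v s = 0) → (∀ s, R < s → w s = 0) → (∀ s, w s ≤ ENNReal.ofReal (η / R ^ 2)) → (∀ (n : ℕ) (y : Fin n → Space) (c : Fin n → ℝ), 0 ≤ ∑ i, ∑ j, c i * c j * (w ‖y i - y j‖).toReal) → (∀ s, 0 ≤ f s ∧ f s ≤ 1) → (∀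 s, R ≤ s → f s = 1) → (∀ ε : ℝ, 0 < ε → ∃ K : NNReal, LipschitzOnWith K (fun x : Space => f ‖x‖) {x : Space | ε ≤ ‖x‖}) → 2 * scatteringFunctional v (fun x : Space => f ‖x‖) = ∫⁻ x : Space, w ‖x‖ * ENNReal.ofReal (f ‖x‖ ^ 2) → (∀ φ : Space → ℝ, IsScatteringTrial φ → 2 * scatteringFunctional v (fun x : Space => f ‖x‖) + ∫⁻ x : Space, w ‖x‖ * ENNReal.ofReal (φ x ^ 2) ≤ 2 * scatteringFunctional v φ + ∫⁻ x : Space, w ‖x‖ * ENNReal.ofReal (f ‖x‖ ^ 2)) → M ≤ ρ * R ^ 3 → ENNReal.ofReal (ρ * R ^ 2) * (∫⁻ x : Space, w ‖x‖) ≤ ENNReal.ofReal η → ENNReal.ofReal ρ * (∫⁻ x : Space, ENNReal.ofReal (1 - f ‖x‖ ^ 2)) ≤ ENNReal.ofReal ε₀ → ∃ c : ℝ, 0 < c ∧ ∀ᶠ N : ℕ in Filter.atTop, ∃ δ : ENNReal, 0 < δ ∧ ∀ Ψ : PeriodicTrialState N (sideLength ρ N), periodicEnergy v Ψ ≤ periodicGroundStateEnergy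 v N (sideLength ρ N) + δ → ENNReal.ofReal (c * N) ≤ condensateOccupation N (sideLength ρ N) Ψ.ψ

/-- item stmt-AtomisticToContinuum-14632 · crux · rank 4 · open · by planner
why it might fail: Exactness AND positive type force amplitude tuning: needs existence and κ-continuity of the zero-energy minimiser of the SIGN-INDEFINITE v − κφ₁ for every measurable v ≥ 0 incl. hard cores, f′(R)=0 from the energy identity, and 0≤f≤1 (needs R₁≫R₀); a wrong regularity clause makes it false.
sources: LSSY2005, Fournais2020, Literature.MathematicalPhysics.QuantumManyBody.BoseGas.LSSY2005_scatteringSolution, doi:10.1007/BF02123482, arXiv:2208.08931, BastiCenatiempoSchlein2021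
[crux] existence of the EXACT positive-type window splitting (card J0): for every repulsive
finite-range v there are A ≥ 0 and R₁ > 0 such that for every R ≥ R₁ there exist a measurable Kac
part w (0 ≤ w ≤ A/R³, w = 0 beyond R, ∫_{ℝ³}w ≤ A, x ↦ w(|x|) of positive type) and a profile f (0 ≤
f ≤ 1, f = 1 on [R,∞), punctured-Lipschitz, ∫(1−f²) ≤ AR²) satisfying the two splitting relations of
DressedKacCondensation with v (and v = 0 beyond R). Construction (amplitude tuning): fix a
positive-type radial bump φ₁ supported in the unit ball (an autocorrelation 1_B∗1_B, or a Wendland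
function), put w_κ = κφ₁(·/R); the zero-energy minimiser f_κ of E_{v−w_κ} on {φ = 1 off B_R} exists
for κφ₁(0)R² < 2π² (coercive), its minimum m(κ) is concave, continuous, m(0) = 8πa/(1−a/R) > 0 and
m(κ*) ≤ 0 at the Born value κ*R³∫φ₁ ≈ 8πa; at the zero κ₀ of m the energy identity gives f′(R⁻) = 0,
so f extends by 1 to a global zero-energy solution (ground-state substitution ⇒ global minimality),
Sturm comparison keeps f > 0 off the core, and 0 ≤ f ≤ 1, 1 − f ≤ ca/r on [R₀,R] once R₁/R₀ is
large; a = 0 ⇒ v = 0 a.e. ⇒ w = 0, f = 1, A = 0. [difficulty: L] -/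
@[route_item "route-AtomisticToContinuum-BECDressedKac", crux]
def SplittingConstruction : Prop :=
  open Literature.MathematicalPhysics.QuantumManyBody.BoseGas in ∀ v : ℝ → ENNReal, IsRepulsiveFiniteRange v → ∃ A R₁ : ℝ, 0 ≤ A ∧ 0 < R₁ ∧ ∀ R : ℝ, R₁ ≤ R → ∃ (w : ℝ → ENNReal) (f : ℝ → ℝ), Measurable w ∧ (∀ s, R < s → v s = 0) ∧ (∀ s, R < s → w s = 0) ∧ (∀ s, w s ≤ ENNReal.ofReal (A / R ^ 3)) ∧ (∫⁻ x : Space, w ‖x‖) ≤ ENNReal.ofReal A ∧ (∀ (n : ℕ) (y : Fin n → Space) (c : Fin n → ℝ), 0 ≤ ∑ i, ∑ j, c i * c j * (w ‖y i - y j‖).toReal) ∧ (∀ s, 0 ≤ f s ∧ f s ≤ 1) ∧ (∀ s, R ≤ s → f s = 1) ∧ (∀ ε : ℝ, 0 < ε → ∃ K : NNReal, LipschitzOnWith K (fun x : Space => f ‖x‖) {x : Space | ε ≤ ‖x‖}) ∧ (∫⁻ x : Space, ENNReal.ofReal (1 - f ‖x‖ ^ 2)) ≤ ENNReal.ofReal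 (A * R ^ 2) ∧ 2 * scatteringFunctional v (fun x : Space => f ‖x‖) = ∫⁻ x : Space, w ‖x‖ * ENNReal.ofReal (f ‖x‖ ^ 2) ∧ (∀ φ : Space → ℝ, IsScatteringTrial φ → 2 * scatteringFunctional v (fun x : Space => f ‖x‖) + ∫⁻ x : Space, w ‖x‖ * ENNReal.ofReal (φ x ^ 2) ≤ 2 * scatteringFunctional v φ + ∫⁻ x : Space, w ‖x‖ * ENNReal.ofReal (f ‖x‖ ^ 2))

/-- item stmt-AtomisticToContinuum-0827 · crux · rank 5 · open · by planner
why it might fail: The torus hypothesis never fires on the Dirichlet ground state (wall energy ≫ δ above E₀^per; interior restrictions are neither periodic nor sharp-N): no energy-comparison proof; needs a structural transfer not in print; BEC can be BC-sensitive (Robinson1976).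
sources: LSSY2005, BoccatoSeiringer2023, Basti2022, Junge2026, Robinson1976, Fournais2020
[crux] BoundaryTransferWeak (mode-free boundary-condition transfer, per potential): for each
repulsive finite-range v, PeriodicBEC(v) implies ∃ρ₀>0 ∀ρ∈(0,ρ₀) HasGroundStateBEC v ρ (Dirichlet
ground state, λ_max(γ) ≥ cN via condensateNumber). Not glue: near-minimiser slacks are O(N/L²) while
Dirichlet/periodic energies differ by a boundary term ≫ N/L², so no energy-comparison proof;
expected route: Neumann bracketing of interior sub-boxes (−Δ_Dir ≥ ⊕−Δ_Neu, v ≥ 0) + a mode-free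
criterion (λ_max ≥ tr γ²/N). Only the ENERGY analogue is in print (LiebSeiringerSolovejYngvason2005
Ch. 2 after (2.8)). v ≡ 0: hypothesis and conclusion both true. -/
@[route_item "route-AtomisticToContinuum-BECDressedKac", crux]
def BoundaryTransferWeak : Prop :=
  ∀ v : ℝ → ENNReal, Literature.MathematicalPhysics.QuantumManyBody.BoseGas.IsRepulsiveFiniteRange v → (∃ ρ₀ : ℝ, 0 < ρ₀ ∧ ∀ ρ : ℝ, 0 < ρ → ρ < ρ₀ → ∃ c : ℝ, 0 < c ∧ ∀ᶠ N : ℕ in Filter.atTop, ∃ δ : ENNReal, 0 < δ ∧ ∀ Ψ : Literature.MathematicalPhysics.QuantumManyBody.BoseGas.PeriodicTrialState N (Literature.MathematicalPhysics.QuantumManyBody.BoseGas.sideLength ρ N), Literature.MathematicalPhysics.QuantumManyBody.BoseGas.periodicEnergy v Ψ ≤ Literature.MathematicalPhysics.QuantumManyBody.BoseGas.periodicGroundStateEnergy v N (Literature.MathematicalPhysics.QuantumManyBody.BoseGas.sideLength ρ N) + δ → ENNReal.ofReal (c * N) ≤ Literature.MathematicalPhysics.QuantumManyBody.BoseGas.condensateOccupation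 N (Literature.MathematicalPhysics.QuantumManyBody.BoseGas.sideLength ρ N) Ψ.ψ) → ∃ ρ₀ : ℝ, 0 < ρ₀ ∧ ∀ ρ : ℝ, 0 < ρ → ρ < ρ₀ → Literature.MathematicalPhysics.QuantumManyBody.BoseGas.HasGroundStateBEC v ρ

/-- item stmt-AtomisticToContinuum-14633 · support · rank 9 · closed · proved by Summit.AtomisticToContinuum.BoseEinsteinCondensation.Theorems.windowArithmetic_proof @ e8e42501c363 (prover) · by planner
sources: LSSY2005
[support] the window is non-empty for every potential at every small density: SplittingConstruction
→ DressedKacCondensation → PeriodicBEC. Proof (done in the planner's folder Check.lean, rc 0, axioms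
propext/Classical.choice/Quot.sound; to be re-landed in Theorems/ by any prover): B := A+1, R* :=
max(R₁, B/η, MB/η, MB/ε₀), ρ₀ := M/R*³; for 0 < ρ < ρ₀ put R := (M/ρ)^{1/3} ≥ R*, so ρR³ = M, w ≤
A/R³ ≤ η/R², ρR²∫w ≤ ρR²A = MA/R ≤ η, ρ∫(1−f²) ≤ ρAR² = MA/R ≤ ε₀; instantiate
DressedKacCondensation at (v, w, f, R, ρ). [difficulty: provable-now] -/
@[route_item "route-AtomisticToContinuum-BECDressedKac", crux]
def WindowArithmetic : Prop :=
  SplittingConstruction → DressedKacCondensation → PeriodicBEC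

-- `WindowArithmetic` holds: proved by `Summit.AtomisticToContinuum.BoseEinsteinCondensation.Theorems.windowArithmetic_proof` @ e8e42501c363 (its module imports this route file, so no `_holds` link can be stated here).

/-- item stmt-AtomisticToContinuum-14634 · support · rank 9 · closed · proved by Summit.AtomisticToContinuum.BoseEinsteinCondensation.Theorems.kacWindowOfDressed_proof @ 3ff3230101a0 (prover) · by planner
sources: LSSY2005, Lieb1966
[support] the pure Kac crux is the f ≡ 1, v := w instance of the dressed crux:
DressedKacCondensation → KacWindowCondensation (2·𝓔_w[1] = ∫w, ∫w φ² ≤ 2·𝓔_w[φ], defect 0). PROVED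
in the planner's folder Check.lean (rc 0) — the interface check that the dressed hypotheses are met
by f ≡ 1; it also makes KacWindowCondensation refutation-load-bearing (¬Kac ⇒ ¬Dressed).
[difficulty: provable-now] -/
@[route_item "route-AtomisticToContinuum-BECDressedKac"]
def KacWindowOfDressed : Prop :=
  DressedKacCondensation → KacWindowCondensation

-- `KacWindowOfDressed` holds: proved by `Summit.AtomisticToContinuum.BoseEinsteinCondensation.Theorems.kacWindowOfDressed_proof` @ 3ff3230101a0 (its module imports this route file, so no `_holds` link can be stated here).

/-- item stmt-AtomisticToContinuum-14635 · assembly · rank 1 · closed · proved by Summit.AtomisticToContinuum.BoseEinsteinCondensation.Theorems.becDressedKac_assembly_proof (prover) · by planner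
sources: LSSY2005
[assembly] SplittingConstruction → DressedKacCondensation → WindowArithmetic → BoundaryTransferWeak
→ BoseEinsteinCondensation (the sub-problem Statement decl). -/
@[route_item "route-AtomisticToContinuum-BECDressedKac"]
def Assembly : Prop :=
  SplittingConstruction → DressedKacCondensation → WindowArithmetic → BoundaryTransferWeak → _root_.BoseEinsteinCondensation

-- `Assembly` holds: proved by `Summit.AtomisticToContinuum.BoseEinsteinCondensation.Theorems.becDressedKac_assembly_proof` (its module imports this route file, so no `_holds` link can be stated here).

/-! D-0027 §2.1 — DECIDING THEOREM (planner-authored via `route open/edit --closes-file`; by planner-plancard-AtomisticToContinuum-BoseEin-6f592076-g2-0 2026-08-15T19:10:25Z):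
its hypotheses are this route's items and its conclusion the sub-problem Statement (glue_lint), and it elaborates with this file. -/

@[closes "route-AtomisticToContinuum-BECDressedKac"] theorem closes (h₁ : SplittingConstruction) (h₂ : DressedKacCondensation) (h₃ : WindowArithmetic)
    (h₄ : BoundaryTransferWeak) : _root_.BoseEinsteinCondensation :=
  fun v hv => h₄ v hv (h₃ h₁ h₂ v hv)

end Summit.AtomisticToContinuum.BoseEinsteinCondensation.Theses.BECDressedKac
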